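import Summits.SmoothPoincare4.SmoothPoincare4.Theorems.ConvexBisectionAcyclicBisectionExistsHgapTwistRows
import Summits.SmoothPoincare4.SmoothPoincare4.Theorems.ConvexBisectionAcyclicBisectionExistsHgapTwistColumn
import Summits.SmoothPoincare4.SmoothPoincare4.Theorems.ConvexBisectionAcyclicBisectionExistsHgapTwistWind
import HarnessLib

/-!
# Hgap ▸ part B (page twisting of the straightened dual framed knot), brick R8 (assembly), file 2:
# the belt matrix `M` and the winding number of the model loop
(wave 7, crux stmt-SmoothPoincare4-10508, line `modp-braid-orbits`, stub `stub_T3_dualPresentation` (T3)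
▸ node `Hgap` ▸ part B `helper_Hgap_twisting` ▸ (R8); registered sub-goal `helper_frameSign_eq_det`; main result `beltMatrix_package`)

The first-order structure of the boundary open book of `X` at the belt circle of the `j`-th handle,
pushed through the seam `Ψ` and a smooth `w`-rescaling `R₁` flattening the belt circle into the page of
direction `c` (`…HgapTwistRadial.lean`): the differential `ℓ_u = dΘ̂_u (0)` of the page slope
`Θ̂_u (m) = S_c (w (R₁ (seam (β♭ (u, m)))))` along the fibre through the belt point `u`.  This file
assembles G2's bricks into the BELT MATRIX `M = [[p, q], [r, s]]` (`beltMatrix_package`; the registered sub-goal of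
this file is the bridge `helper_frameSign_eq_det`):

* §1 rigidity ⇒ bilinearity: `ℓ_u = u₀ ℓ_{e₀} + u₁ ℓ_{e₁}` (`fderiv_beltSlope_radial`: `ℓ_u (v)` for unit `v` is
  a linear function of `u`; two linear functionals agreeing on the unit circle agree), so
  `ℓ_u (X) = (u₀ p + u₁ q) X₀ + (u₀ r + u₁ s) X₁`;
* §2 the rows through Z4's page tube `Φ` of `K_j` (`helper_beltRows_pageTube`): `ℓ_{e_k} (v) = κ' (A(v) e_k)₁`,
  `A = CircleTube.fibreDeriv (h j).boundaryTube Φ`, whose determinant has the sign `ε` of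
  `CircleTube.frameSign` (`frameSign_eq_det`); hence `det M ≠ 0` (`det_ne_zero_of_linearLoop_ne_zero`) and,
  by the count `helper_wind_beltCount` and the column lemma `helper_pageTwisting_eq_wind_frameCol`,
  **the model loop `(σ (M u)₁, (M u)₀)` winds `σ · ε · pageTwisting (K_j, attaching framing)` times**.

Everything is proved; no named facts, no `sorry`.  References: J. B. Etnyre, T. Fuller, IMRN 2006, Thm. 1
(proof, p. 8) [EtnyreFuller2006]; A. A. Kosinski, *Differential Manifolds* (1993), III (3.1) [Kosinski1993].
-/

noncomputable section

set_option linter.dupNamespace false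

open scoped Manifold ContDiff Topology ComplexConjugate RealInnerProductSpace
open Set Function Metric Complex
open Literature.Topology.FourManifolds Literature.Topology.FourManifolds.HandleAttachingMap
  Literature.Topology.FourManifolds.LefschetzBase Literature.Topology.PlaneTopology
  Literature.Geometry.Symplectic

namespace Summit.SmoothPoincare4.SmoothPoincare4.Theorems.AcyclicBisectionExists.ModpBraidOrbits

/-! ## §0 Plane bookkeeping -/

namespace HBAssembly

/-- Two continuous linear functionals of the plane that agree on the unit circle agree. [folklore] -/
theorem clm_eq_of_eq_on_sphere {f₁ f₂ : EuclideanSpace ℝ (Fin 2) →L[ℝ] ℝ}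
    (h : ∀ v : sphere (0 : EuclideanSpace ℝ (Fin 2)) 1, f₁ v = f₂ v) : f₁ = f₂ := by
  ext v
  by_cases hv : v = 0
  · rw [hv, map_zero, map_zero]
  · have hn : ‖v‖ ≠ 0 := norm_ne_zero_iff.2 hv
    have hmem : ‖v‖⁻¹ • v ∈ sphere (0 : EuclideanSpace ℝ (Fin 2)) 1 := by
      rw [mem_sphere_zero_iff_norm, norm_smul, norm_inv, norm_norm, inv_mul_cancel₀ hn]
    have key : f₁ (‖v‖⁻¹ • v) = f₂ (‖v‖⁻¹ • v) := h ⟨‖v‖⁻¹ • v, hmem⟩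
    have e : v = ‖v‖ • (‖v‖⁻¹ • v) := by rw [smul_smul, mul_inv_cancel₀ hn, one_smul]
    have e1 : f₁ v = ‖v‖ • f₁ (‖v‖⁻¹ • v) := by rw [← map_smul, ← e]
    have e2 : f₂ v = ‖v‖ • f₂ (‖v‖⁻¹ • v) := by rw [← map_smul, ← e]
    rw [e1, e2, key]

/-- The base point `circlePt 0 = e₀`. [folklore] -/
theorem coe_circlePt_zero : ((circlePt 0 : sphere (0 : EuclideanSpace ℝ (Fin 2)) 1) : EuclideanSpace ℝ (Fin 2)) = planeE0 := by
  ext i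
  fin_cases i <;> simp [planeE0]

/-- The point `circlePt (1/4) = e₁`. [folklore] -/
theorem coe_circlePt_quarter :
    ((circlePt (1 / 4) : sphere (0 : EuclideanSpace ℝ (Fin 2)) 1) : EuclideanSpace ℝ (Fin 2)) = planeE1 := by
  have e : 2 * Real.pi * (1 / 4) = Real.pi / 2 := by ring
  ext i
  fin_cases i
  · show ((circlePt (1 / 4) : sphere (0 : EuclideanSpace ℝ (Fin 2)) 1) : EuclideanSpace ℝ (Fin 2)) 0 = planeE1 0
    rw [circlePt_apply_zero, e, Real.cos_pi_div_two, planeE1_apply_zero]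
  · show ((circlePt (1 / 4) : sphere (0 : EuclideanSpace ℝ (Fin 2)) 1) : EuclideanSpace ℝ (Fin 2)) 1 = planeE1 1
    rw [circlePt_apply_one, e, Real.sin_pi_div_two, planeE1_apply_one]

/-- `circlePt t = cos 2πt · e₀ + sin 2πt · e₁`. [folklore] -/
theorem coe_circlePt_eq_planeE (t : ℝ) :
    ((circlePt t : sphere (0 : EuclideanSpace ℝ (Fin 2)) 1) : EuclideanSpace ℝ (Fin 2)) =
      Real.cos (2 * Real.pi * t) • planeE0 + Real.sin (2 * Real.pi * t) • planeE1 := by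
  ext i
  fin_cases i <;> simp [planeE0, planeE1]

/-- **The frame sign is the determinant over the norm of the first column**:
`frameSign = ⟪A e₁, J (A e₀/‖A e₀‖)⟫ = det A / ‖A e₀‖`. [folklore] -/
theorem frameSign_eq_det {Y : Type*} [TopologicalSpace Y] [ChartedSpace (EuclideanSpace ℝ (Fin 3)) Y]
    (Φ₁ Φ₂ : CircleTube Y) (x : sphere (0 : EuclideanSpace ℝ (Fin 2)) 1) :
    CircleTube.frameSign Φ₁ Φ₂ x = ‖CircleTube.frameCol Φ₁ Φ₂ x‖⁻¹ *
      ((CircleTube.fibreDeriv Φ₁ Φ₂ x planeE0) 0 * (CircleTube.fibreDeriv Φ₁ Φ₂ x planeE1) 1 -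
        (CircleTube.fibreDeriv Φ₁ Φ₂ x planeE1) 0 * (CircleTube.fibreDeriv Φ₁ Φ₂ x planeE0) 1) := by
  simp only [CircleTube.frameSign, CircleTube.frameVec, CircleTube.frameCol, NormedSpace.normalize, quarterTurn,
    PiLp.inner_apply, Fin.sum_univ_two, PiLp.smul_apply, smul_eq_mul]
  simp
  ring

/-- If `0 < ε · frameSign` then `0 < ε · det A`. [folklore] -/
theorem det_fibreDeriv_sign {Y : Type*} [TopologicalSpace Y] [ChartedSpace (EuclideanSpace ℝ (Fin 3)) Y]
    {Φ₁ Φ₂ : CircleTube Y} (hcore : ∀ θ, Φ₁.core θ = Φ₂.core θ) {ε : ℝ}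
    (hε : ∀ x, 0 < ε * CircleTube.frameSign Φ₁ Φ₂ x) (x : sphere (0 : EuclideanSpace ℝ (Fin 2)) 1) :
    0 < ε * ((CircleTube.fibreDeriv Φ₁ Φ₂ x planeE0) 0 * (CircleTube.fibreDeriv Φ₁ Φ₂ x planeE1) 1 -
        (CircleTube.fibreDeriv Φ₁ Φ₂ x planeE1) 0 * (CircleTube.fibreDeriv Φ₁ Φ₂ x planeE0) 1) := by
  have h := hε x
  rw [frameSign_eq_det] at h
  have hn : 0 < ‖CircleTube.frameCol Φ₁ Φ₂ x‖ := norm_pos_iff.2 (CircleTube.frameCol_ne_zero hcore x)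
  have e : ε * ((CircleTube.fibreDeriv Φ₁ Φ₂ x planeE0) 0 * (CircleTube.fibreDeriv Φ₁ Φ₂ x planeE1) 1 -
      (CircleTube.fibreDeriv Φ₁ Φ₂ x planeE1) 0 * (CircleTube.fibreDeriv Φ₁ Φ₂ x planeE0) 1) =
      ‖CircleTube.frameCol Φ₁ Φ₂ x‖ * (ε * (‖CircleTube.frameCol Φ₁ Φ₂ x‖⁻¹ *
        ((CircleTube.fibreDeriv Φ₁ Φ₂ x planeE0) 0 * (CircleTube.fibreDeriv Φ₁ Φ₂ x planeE1) 1 -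
          (CircleTube.fibreDeriv Φ₁ Φ₂ x planeE1) 0 * (CircleTube.fibreDeriv Φ₁ Φ₂ x planeE0) 1))) := by
    field_simp
  rw [e]
  exact mul_pos hn h

/-- The loop of first columns `toC (A(e^{2πit}) e₀)` is a non-vanishing loop. [folklore] -/
theorem isNonvanishingLoop_frameCol {Y : Type*} [TopologicalSpace Y] [ChartedSpace (EuclideanSpace ℝ (Fin 3)) Y]
    {Φ₁ Φ₂ : CircleTube Y} (hcore : ∀ θ, Φ₁.core θ = Φ₂.core θ) :
    IsNonvanishingLoop fun t => toC (CircleTube.frameCol Φ₁ Φ₂ (circlePt t)) := by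
  have hFc : Continuous fun t => CircleTube.frameCol Φ₁ Φ₂ (circlePt t) :=
    (CircleTube.contMDiff_frameCol hcore).continuous.comp continuous_circlePt
  refine ⟨(contDiff_toC.continuous.comp hFc).continuousOn, fun t _ h0 => ?_, ?_⟩
  · have h1 : ‖CircleTube.frameCol Φ₁ Φ₂ (circlePt t)‖ = 0 := by rw [← norm_toC, h0, norm_zero]
    exact CircleTube.frameCol_ne_zero hcore _ (norm_eq_zero.1 h1)
  · show toC (CircleTube.frameCol Φ₁ Φ₂ (circlePt 0)) = toC (CircleTube.frameCol Φ₁ Φ₂ (circlePt 1))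
    rw [circlePt_one_eq_zero]

end HBAssembly

open HBAssembly

/-! ## §1 Rigidity: the differential of the belt slope is bilinear -/

section Matrix

variable {g : ℕ} {ι : Type} [Finite ι] {h : ι → HandleAttachingMap 3 2 (Base g)}
  {X : Type} [TopologicalSpace X] [ChartedSpace (EuclideanHalfSpace 4) X] [IsManifold (𝓡∂ 4) ∞ X]
  (D : MultiAttachmentData h (𝓡∂ 4) X) (bX : BoundaryData (𝓡∂ 4) X (𝓡 3))
  (Ψ : bX.carrier ≃ₘ⟮𝓡 3, 𝓡 3⟯ (bBase g).carrier)
  (hpage : ∀ (y : bX.carrier) (a : ↥(coresComplement h)), bX.incl y = D.jA a →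
    ∃ c : ℝ, 0 < c ∧ w g ((bBase g).incl (Ψ y)).1 = (c : ℂ) * w g (a : Base g).1)
  (j : ι) {c : ℂ} (hc : ‖c‖ = 1) (hKc : ∀ v, (h j).attachingCircle v ∈ page g c)
  {R₁ : Base g → Base g} (hR₁ : ContMDiff (𝓡∂ 4) (𝓡∂ 4) ∞ R₁)
  (hRw : ∀ x : Base g, ∃ t : ℝ, 0 < t ∧ w g (R₁ x).1 = (t : ℂ) * w g x.1)
  (hflat : ∀ θ : sphere (0 : EuclideanSpace ℝ (Fin 2)) 1,
    w g (R₁ ((BoundaryManifold.boundaryData 3 (Base g)).incl (seamDiffeo bX (bBase g) Ψ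
      ((beltMap D j).boundaryTube.toHomeo (θ, (0 : EuclideanSpace ℝ (Fin 2))))))).1 = c / 2)

include hpage hc hKc hR₁ hRw hflat in
/-- **Rigidity ⇒ bilinearity**: the differential `ℓ_u = dΘ̂_u (0)` of the belt slope at the belt point
`u` is `u₀ ℓ_{e₀} + u₁ ℓ_{e₁}` — by `fderiv_beltSlope_radial`, `ℓ_u (v) = 4 ‖dΦ_{K v}‖² ⟪D_v u, n(K v)⟫`
for unit `v`, which is linear in `u`; linear functionals agreeing on the unit circle agree.
[cite: EtnyreFuller2006, Thm. 1 (proof, p. 8)] -/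
theorem fderiv_beltSlope_combo (u : sphere (0 : EuclideanSpace ℝ (Fin 2)) 1) :
    fderiv ℝ (fun m : EuclideanSpace ℝ (Fin 2) =>
        (conj c * w g (R₁ ((BoundaryManifold.boundaryData 3 (Base g)).incl (seamDiffeo bX (bBase g) Ψ
          ((beltMap D j).boundaryTube.toHomeo (u, m))))).1).im /
        (conj c * w g (R₁ ((BoundaryManifold.boundaryData 3 (Base g)).incl (seamDiffeo bX (bBase g) Ψ
          ((beltMap D j).boundaryTube.toHomeo (u, m))))).1).re) 0 =
      (u : EuclideanSpace ℝ (Fin 2)) 0 • fderiv ℝ (fun m : EuclideanSpace ℝ (Fin 2) =>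
        (conj c * w g (R₁ ((BoundaryManifold.boundaryData 3 (Base g)).incl (seamDiffeo bX (bBase g) Ψ
          ((beltMap D j).boundaryTube.toHomeo (circlePt 0, m))))).1).im /
        (conj c * w g (R₁ ((BoundaryManifold.boundaryData 3 (Base g)).incl (seamDiffeo bX (bBase g) Ψ
          ((beltMap D j).boundaryTube.toHomeo (circlePt 0, m))))).1).re) 0 +
      (u : EuclideanSpace ℝ (Fin 2)) 1 • fderiv ℝ (fun m : EuclideanSpace ℝ (Fin 2) =>
        (conj c * w g (R₁ ((BoundaryManifold.boundaryData 3 (Base g)).incl (seamDiffeo bX (bBase g) Ψ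
          ((beltMap D j).boundaryTube.toHomeo (circlePt (1 / 4), m))))).1).im /
        (conj c * w g (R₁ ((BoundaryManifold.boundaryData 3 (Base g)).incl (seamDiffeo bX (bBase g) Ψ
          ((beltMap D j).boundaryTube.toHomeo (circlePt (1 / 4), m))))).1).re) 0 := by
  apply clm_eq_of_eq_on_sphere
  intro v
  rw [FunLike.coe_add, FunLike.coe_smul, FunLike.coe_smul, Pi.add_apply,
    Pi.smul_apply, Pi.smul_apply,
    fderiv_beltSlope_radial D bX Ψ hpage j hc hKc hR₁ hRw u v (hflat u),
    fderiv_beltSlope_radial D bX Ψ hpage j hc hKc hR₁ hRw (circlePt 0) v (hflat _),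
    fderiv_beltSlope_radial D bX Ψ hpage j hc hKc hR₁ hRw (circlePt (1 / 4)) v (hflat _),
    coe_circlePt_zero, coe_circlePt_quarter]
  have e : (u : EuclideanSpace ℝ (Fin 2)) = (u : EuclideanSpace ℝ (Fin 2)) 0 • planeE0 +
      (u : EuclideanSpace ℝ (Fin 2)) 1 • planeE1 := plane_eq_smul_add_smul _
  conv_lhs => rw [e]
  rw [map_add, map_smul, map_smul, inner_add_left, real_inner_smul_left, real_inner_smul_left, smul_eq_mul,
    smul_eq_mul]
  ring

/-! ## §2 The belt matrix and the winding number of the model loop -/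

include hpage hc hKc hR₁ hRw hflat in
/-- **The belt matrix `M = [[p, q], [r, s]]` and the winding number of the model loop.**  There are reals
`p, q, r, s` with
(i) `dΘ̂_u (0) X = (u₀ p + u₁ q) X₀ + (u₀ r + u₁ s) X₁` for every belt point `u` (`= ⟪M u, X⟫`);
(ii) `det M = p s − r q ≠ 0`;
(iii) for `σ = ±1` the model loop `(σ (M u)₁, (M u)₀)`, `u = e^{2πit}`, winds
`σ · ε · pageTwisting (K_j, attaching framing)` times, `ε` the frame sign of `A = (page tube)⁻¹ ∘ (h j)♭`
(rows `⟪M e_k, v⟫ = κ' (A(v) e_k)₁` by `helper_beltRows_pageTube`, count `helper_wind_beltCount`, column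
`helper_pageTwisting_eq_wind_frameCol`). [cite: EtnyreFuller2006, Thm. 1 (proof, p. 8)] -/
theorem beltMatrix_package {Φ : CircleTube (bBase g).carrier} {κ' r' : ℝ} (hκ' : 0 < κ') (hr' : 0 < r')
    (hΦcore : ∀ ψ, (bBase g).incl (Φ.core ψ) = (h j).attachingCircle ψ)
    (hΦder : ∀ t : ℝ, HasFDerivAt (fun v : EuclideanSpace ℝ (Fin 2) =>
        ((bBase g).incl (Φ.toHomeo (circlePt t, v))).1)
      ((EuclideanSpace.proj (𝕜 := ℝ) (0 : Fin 2)).smulRight (r' • cplxJ (deriv (ambCurve g (h j).attachingCircle) t)) +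
        (EuclideanSpace.proj (𝕜 := ℝ) (1 : Fin 2)).smulRight (κ' • rotField g ((h j).attachingCircle (circlePt t)).1)) 0)
    {ε : ℤ} (hε : ε = 1 ∨ ε = -1) (hεs : ∀ x, 0 < (ε : ℝ) * CircleTube.frameSign (h j).boundaryTube Φ x) :
    ∃ p q r s : ℝ,
      (∀ (u : sphere (0 : EuclideanSpace ℝ (Fin 2)) 1) (Xv : EuclideanSpace ℝ (Fin 2)),
        fderiv ℝ (fun m : EuclideanSpace ℝ (Fin 2) =>
          (conj c * w g (R₁ ((BoundaryManifold.boundaryData 3 (Base g)).incl (seamDiffeo bX (bBase g) Ψ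
            ((beltMap D j).boundaryTube.toHomeo (u, m))))).1).im /
          (conj c * w g (R₁ ((BoundaryManifold.boundaryData 3 (Base g)).incl (seamDiffeo bX (bBase g) Ψ
            ((beltMap D j).boundaryTube.toHomeo (u, m))))).1).re) 0 Xv =
        ((u : EuclideanSpace ℝ (Fin 2)) 0 * p + (u : EuclideanSpace ℝ (Fin 2)) 1 * q) * Xv 0 +
          ((u : EuclideanSpace ℝ (Fin 2)) 0 * r + (u : EuclideanSpace ℝ (Fin 2)) 1 * s) * Xv 1) ∧
      p * s - r * q ≠ 0 ∧
      ∀ σ : ℤ, (σ = 1 ∨ σ = -1) →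
        wind (fun t => (⟨σ * (r * Real.cos (2 * Real.pi * t) + s * Real.sin (2 * Real.pi * t)),
          p * Real.cos (2 * Real.pi * t) + q * Real.sin (2 * Real.pi * t)⟩ : ℂ)) =
        σ * ε * pageTwisting g (h j).attachingCircle (h j).attachingFraming := by
  -- the two basic functionals `ℓ_{e₀}`, `ℓ_{e₁}` and the matrix entries
  set ℓ0 := fderiv ℝ (fun m : EuclideanSpace ℝ (Fin 2) =>
    (conj c * w g (R₁ ((BoundaryManifold.boundaryData 3 (Base g)).incl (seamDiffeo bX (bBase g) Ψ
      ((beltMap D j).boundaryTube.toHomeo (circlePt 0, m))))).1).im /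
    (conj c * w g (R₁ ((BoundaryManifold.boundaryData 3 (Base g)).incl (seamDiffeo bX (bBase g) Ψ
      ((beltMap D j).boundaryTube.toHomeo (circlePt 0, m))))).1).re) 0 with hℓ0
  set ℓ1 := fderiv ℝ (fun m : EuclideanSpace ℝ (Fin 2) =>
    (conj c * w g (R₁ ((BoundaryManifold.boundaryData 3 (Base g)).incl (seamDiffeo bX (bBase g) Ψ
      ((beltMap D j).boundaryTube.toHomeo (circlePt (1 / 4), m))))).1).im /
    (conj c * w g (R₁ ((BoundaryManifold.boundaryData 3 (Base g)).incl (seamDiffeo bX (bBase g) Ψ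
      ((beltMap D j).boundaryTube.toHomeo (circlePt (1 / 4), m))))).1).re) 0 with hℓ1
  set A := CircleTube.fibreDeriv (h j).boundaryTube Φ with hA
  have hcore : ∀ θ, (h j).boundaryTube.core θ = Φ.core θ := boundaryTube_core_eq_of_incl_core (h j) hΦcore
  -- the rows through the page tube: `ℓ_{e_k} (e^{2πit}) = κ' (A e_k)₁`
  have hrow0 : ∀ t : ℝ, ℓ0 (circlePt t : EuclideanSpace ℝ (Fin 2)) = κ' * (A (circlePt t) planeE0) 1 := by
    intro t
    rw [hℓ0, fderiv_beltSlope_radial D bX Ψ hpage j hc hKc hR₁ hRw (circlePt 0) (circlePt t) (hflat _),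
      coe_circlePt_zero, beltRow_eq_pageTube (h j) hc hKc hΦcore hΦder t planeE0]
  have hrow1 : ∀ t : ℝ, ℓ1 (circlePt t : EuclideanSpace ℝ (Fin 2)) = κ' * (A (circlePt t) planeE1) 1 := by
    intro t
    rw [hℓ1, fderiv_beltSlope_radial D bX Ψ hpage j hc hKc hR₁ hRw (circlePt (1 / 4)) (circlePt t) (hflat _),
      coe_circlePt_quarter, beltRow_eq_pageTube (h j) hc hKc hΦcore hΦder t planeE1]
  -- the entries
  refine ⟨ℓ0 planeE0, ℓ1 planeE0, ℓ0 planeE1, ℓ1 planeE1, fun u Xv => ?_, ?_, ?_⟩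
  · rw [fderiv_beltSlope_combo D bX Ψ hpage j hc hKc hR₁ hRw hflat u, FunLike.coe_add,
      FunLike.coe_smul, FunLike.coe_smul, Pi.add_apply, Pi.smul_apply, Pi.smul_apply]
    have eX : Xv = Xv 0 • planeE0 + Xv 1 • planeE1 := plane_eq_smul_add_smul _
    conv_lhs => rw [eX]
    simp only [map_add, map_smul, smul_eq_mul]
    ring
  · -- (ii) `det M ≠ 0`: the linear loop `(ℓ_{e₀}, ℓ_{e₁}) (e^{2πit}) = κ' · row₂ (A)` never vanishes
    have hlin : ∀ t : ℝ, (ℓ0 planeE0 * Real.cos (2 * Real.pi * t) + ℓ0 planeE1 * Real.sin (2 * Real.pi * t),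
        ℓ1 planeE0 * Real.cos (2 * Real.pi * t) + ℓ1 planeE1 * Real.sin (2 * Real.pi * t)) ≠ (0, 0) := by
      intro t h0
      rw [Prod.mk.injEq] at h0
      have e0 : ℓ0 (circlePt t : EuclideanSpace ℝ (Fin 2)) = 0 := by
        rw [coe_circlePt_eq_planeE, map_add, map_smul, map_smul, smul_eq_mul, smul_eq_mul]; linarith [h0.1]
      have e1 : ℓ1 (circlePt t : EuclideanSpace ℝ (Fin 2)) = 0 := by
        rw [coe_circlePt_eq_planeE, map_add, map_smul, map_smul, smul_eq_mul, smul_eq_mul]; linarith [h0.2]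
      rw [hrow0] at e0
      rw [hrow1] at e1
      have a0 : (A (circlePt t) planeE0) 1 = 0 := (mul_eq_zero.1 e0).resolve_left hκ'.ne'
      have a1 : (A (circlePt t) planeE1) 1 = 0 := (mul_eq_zero.1 e1).resolve_left hκ'.ne'
      have hd := det_fibreDeriv_sign hcore hεs (circlePt t)
      rw [← hA, a0, a1] at hd
      simp at hd
    have := det_ne_zero_of_linearLoop_ne_zero hlin
    intro h0; apply this; linear_combination h0
  · -- (iii) the count
    intro σ hσ
    set f₁ : ℝ → ℝ := fun t => κ' * (A (circlePt t) planeE0) 0 with hf₁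
    set g₁ : ℝ → ℝ := fun t => κ' * (A (circlePt t) planeE1) 0 with hg₁
    have hf₁c : Continuous f₁ := by
      have h1 : Continuous fun t : ℝ => A (circlePt t) planeE0 :=
        ((CircleTube.contMDiff_fibreDeriv hcore).clm_apply contMDiff_const).continuous.comp continuous_circlePt
      exact continuous_const.mul ((EuclideanSpace.proj (𝕜 := ℝ) (0 : Fin 2)).continuous.comp h1)
    have hf₁0 : f₁ 0 = f₁ 1 := by simp only [hf₁, circlePt_one_eq_zero]
    have hdet : ∀ t : ℝ, 0 < (ε : ℝ) * (f₁ t * (ℓ1 planeE0 * Real.cos (2 * Real.pi * t) +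
        ℓ1 planeE1 * Real.sin (2 * Real.pi * t)) -
        g₁ t * (ℓ0 planeE0 * Real.cos (2 * Real.pi * t) + ℓ0 planeE1 * Real.sin (2 * Real.pi * t))) := by
      intro t
      have e0 : ℓ0 planeE0 * Real.cos (2 * Real.pi * t) + ℓ0 planeE1 * Real.sin (2 * Real.pi * t) =
          κ' * (A (circlePt t) planeE0) 1 := by
        rw [← hrow0, coe_circlePt_eq_planeE, map_add, map_smul, map_smul, smul_eq_mul, smul_eq_mul]; ring
      have e1 : ℓ1 planeE0 * Real.cos (2 * Real.pi * t) + ℓ1 planeE1 * Real.sin (2 * Real.pi * t) =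
          κ' * (A (circlePt t) planeE1) 1 := by
        rw [← hrow1, coe_circlePt_eq_planeE, map_add, map_smul, map_smul, smul_eq_mul, smul_eq_mul]; ring
      rw [e0, e1]
      have hd := det_fibreDeriv_sign hcore hεs (circlePt t)
      have e : (ε : ℝ) * (f₁ t * (κ' * (A (circlePt t) planeE1) 1) - g₁ t * (κ' * (A (circlePt t) planeE0) 1)) =
          κ' ^ 2 * ((ε : ℝ) * ((A (circlePt t) planeE0) 0 * (A (circlePt t) planeE1) 1 -
            (A (circlePt t) planeE1) 0 * (A (circlePt t) planeE0) 1)) := by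
        simp only [hf₁, hg₁]; ring
      rw [e]
      positivity
    rw [wind_beltCount hf₁c hf₁0 hε hσ hdet, pageTwisting_eq_wind_frameCol (h j) hc hKc hκ' hr' hΦcore hΦder]
    congr 1
    -- the column loop `(f₁, p cos + r sin) = κ' · toC (A e₀)`
    have hℓ := isNonvanishingLoop_frameCol hcore
    have e : (fun t => (⟨f₁ t, ℓ0 planeE0 * Real.cos (2 * Real.pi * t) + ℓ0 planeE1 * Real.sin (2 * Real.pi * t)⟩ : ℂ)) =
        fun t => ((κ' : ℝ) : ℂ) * toC (CircleTube.frameCol (h j).boundaryTube Φ (circlePt t)) := by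
      funext t
      have e0 : ℓ0 planeE0 * Real.cos (2 * Real.pi * t) + ℓ0 planeE1 * Real.sin (2 * Real.pi * t) =
          κ' * (A (circlePt t) planeE0) 1 := by
        rw [← hrow0, coe_circlePt_eq_planeE, map_add, map_smul, map_smul, smul_eq_mul, smul_eq_mul]; ring
      rw [e0]
      apply Complex.ext
      · simp [hf₁, hA, CircleTube.frameCol]
      · simp [hA, CircleTube.frameCol]
    have hκc : ((κ' : ℝ) : ℂ) ≠ 0 := by exact_mod_cast hκ'.ne'
    rw [e, wind_mul (IsNonvanishingLoop.const hκc) hℓ, wind_const, zero_add]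

end Matrix

/-- **Sub-goal `helper_frameSign_eq_det` of stub `stub_T3_dualPresentation`** (T3 ▸ node `Hgap` ▸ part B
`helper_Hgap_twisting` ▸ (R8) assembly, file 2; wave 7, lead c5): the frame sign of a transition of circle
tubes is `det A / ‖A e₀‖` — the bridge from Y1's orientation character `ε` (`CircleTube.exists_frameSign`) to
the determinant hypothesis of G2's count `helper_wind_beltCount`; the belt matrix package
`beltMatrix_package` of this file rides along. [folklore] -/
theorem helper_frameSign_eq_det : ∀ (Y : Type) [TopologicalSpace Y] [ChartedSpace (EuclideanSpace ℝ (Fin 3)) Y] (Φ₁ Φ₂ : Literature.Topology.FourManifolds.CircleTube Y) (x : Metric.sphere (0 : EuclideanSpace ℝ (Fin 2)) 1), Literature.Topology.FourManifolds.CircleTube.frameSign Φ₁ Φ₂ x = ‖Literature.Topology.FourManifolds.CircleTube.frameCol Φ₁ Φ₂ x‖⁻¹ * ((Literature.Topology.FourManifolds.CircleTube.fibreDeriv Φ₁ Φ₂ x Literature.Topology.FourManifolds.planeE0) 0 * (Literature.Topology.FourManifolds.CircleTube.fibreDeriv Φ₁ Φ₂ x Literature.Topology.FourManifolds.planeE1)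 1 - (Literature.Topology.FourManifolds.CircleTube.fibreDeriv Φ₁ Φ₂ x Literature.Topology.FourManifolds.planeE1) 0 * (Literature.Topology.FourManifolds.CircleTube.fibreDeriv Φ₁ Φ₂ x Literature.Topology.FourManifolds.planeE0) 1) :=
  fun _ _ _ Φ₁ Φ₂ x => frameSign_eq_det Φ₁ Φ₂ x

end Summit.SmoothPoincare4.SmoothPoincare4.Theorems.AcyclicBisectionExists.ModpBraidOrbits

end
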